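import Mathlib
import Summits.Ventures.HodgeRepro.Tier4.Target
import Summits.Ventures.HodgeRepro.Tier4.Line3.Defs
import Summits.Ventures.HodgeRepro.Tier4.Line3.LocaliserS
import Summits.Ventures.HodgeRepro.Tier4.Line3.Majorant
import Summits.Ventures.HodgeRepro.Tier4.Line3.OffMainOrbit
import Summits.Ventures.HodgeRepro.Tier4.Line3.SylvesterTransfer
import Summits.Ventures.HodgeRepro.Tier4.Line3.DefiniteBound
import Summits.Ventures.HodgeRepro.Tier4.Line3.ClassBoundLemmas
import Summits.Ventures.HodgeRepro.Tier4.Line3.ClassBoundGauss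
import Summits.Ventures.HodgeRepro.Tier4.Line3.InvariantMajorantDef
import Summits.Ventures.HodgeRepro.Tier4.Line3.InvariantClassBound
import Summits.Ventures.HodgeRepro.Tier4.Line3.RayMinor

/-!
# Tier4/Line3/RayClassBound — the invariant class bound OFF THE GRAM RAY (the minor rung pays)

Blind re-derivation cell `pub-hodge-repro`, Tier 4 «PROVE THE STEP» (README §9–§10), LINE L3, lemma L3.5
`term_dominated`; seat t4-L2-p3 (gen 3).  Second module of the RAY ROUTE (bus S13403): the invariant class bound
`summand_bound_off_main_inv` (InvariantClassBound, p673954) re-run with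
* the support clause `SuppU` (scalar copies) in place of `LocS.supp`,
* the off-set `orbitOf w ∉ GramRay xm` in place of `orbitOf w ≠ orbitOf (lines xm)`,
* the MINOR rung `exists_gram_minor_size` (RayMinor) in place of the Gram-deviation rung: a large minor
  `M_ij = G_ij(x) G₀₀(xm) − G₀₀(x) G_ij(xm)` forces a large Gram entry of `x` (either `G_ij(x)` or `G₀₀(x)`), and
  `decay_quarter_of_gram_entry` pays exactly as before,
* the growth clause `GrowthInvOn loc` = the body of `GrowthInv` on a bare pair `(level, loc)`.
Everything is stated on `(level, loc)`; no localiser structure enters.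

No printed input is consumed; nothing here asserts anything about the truth of (P); HC_CM is NOT proved by anyone
in this repository.
-/

set_option autoImplicit false

noncomputable section

namespace Summit.Ventures.HodgeRepro.Tier4.Line3

open Summit.Ventures.HodgeRepro.Tier4
open Matrix NumberField
open scoped ComplexConjugate

namespace T4Data

variable (X : T4Data)

/-- **THE `Γ`-INVARIANT GROWTH CLAUSE on a bare pair `(level, loc)`** — the body of `GrowthInv` (InvariantClassBound)
with the localiser structure removed: it reads only `loc N`. -/
def GrowthInvOn (D : X.ThetaData) {level : ℕ → X.Level} (loc : ∀ N, X.Tr (level N)) : Prop :=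
  ∃ B q₂ e c₀ : ℝ, 0 < c₀ ∧ 0 ≤ q₂ ∧ ∀ (N : ℕ) (w : X.LineTuple) (g : Fin 4 → X.Γ),
    ‖X.coefQ D.cf (loc N) (X.rep w)‖ ≤
      B * q₂ ^ N * X.quadMaj e c₀ (X.rep w) g * ∏ k, X.gaussDefAt c₀ (X.rep w k)

/-- `GrowthInv` of a localiser is `GrowthInvOn` of its `loc`. -/
theorem growthInvOn_of_growthInv (D : X.ThetaData) {p : IsDedekindDomain.HeightOneSpectrum (RingOfIntegers X.E)}
    {L₀ : Submodule (RingOfIntegers X.E) (Fin 3 → X.E)} {xm : X.Tuple} (ℓ : X.LocS D p L₀ xm)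
    (h : X.GrowthInv D p L₀ xm ℓ) : X.GrowthInvOn D ℓ.loc := h

/-- **A large minor forces a large Gram entry**: with `G₀ ≥ ‖σ (gram xm i j)‖` for all `i j`,
`‖σ M_ij‖ ≤ G₀ (‖σ G_ij(x)‖ + ‖σ G₀₀(x)‖)`. -/
theorem norm_gramMinor_le (xm x : X.Tuple) (σ : X.E →+* ℂ) {G₀ : ℝ}
    (hG₀ : ∀ i j : Fin 4, ‖σ (X.gram xm i j)‖ ≤ G₀) (i j : Fin 4) :
    ‖σ (X.gramMinor xm x i j)‖ ≤ G₀ * (‖σ (X.gram x i j)‖ + ‖σ (X.gram x 0 0)‖) := by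
  unfold gramMinor
  rw [map_sub, map_mul, map_mul]
  calc ‖σ (X.gram x i j) * σ (X.gram xm 0 0) - σ (X.gram x 0 0) * σ (X.gram xm i j)‖
      ≤ ‖σ (X.gram x i j) * σ (X.gram xm 0 0)‖ + ‖σ (X.gram x 0 0) * σ (X.gram xm i j)‖ := norm_sub_le _ _
    _ = ‖σ (X.gram x i j)‖ * ‖σ (X.gram xm 0 0)‖ + ‖σ (X.gram x 0 0)‖ * ‖σ (X.gram xm i j)‖ := by
        rw [norm_mul, norm_mul]
    _ ≤ ‖σ (X.gram x i j)‖ * G₀ + ‖σ (X.gram x 0 0)‖ * G₀ :=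
        add_le_add (mul_le_mul_of_nonneg_left (hG₀ 0 0) (norm_nonneg _))
          (mul_le_mul_of_nonneg_left (hG₀ i j) (norm_nonneg _))
    _ = G₀ * (‖σ (X.gram x i j)‖ + ‖σ (X.gram x 0 0)‖) := by ring

/-- **THE INVARIANT CLASS BOUND OFF THE GRAM RAY.** Under `SuppU` and `GrowthInvOn`, for a main tuple `xm` with
`xm 0, xm 1` independent (the symmetry `xm 2 = xm 0`, `xm 3 = xm 1` is NOT needed here, unlike in the off-main bound):
there are constants with, for every depth `N`, every line tuple `w` whose orbit is OFF the Gram ray and every `z` in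
the ball,
`‖summand (loc N) w z‖ ≤ B q₂^N · invMajorant D e c₁ w z · (C₁ e^{−κ (N(𝔭)^N)^{1/d}})`. -/
theorem summand_bound_off_ray_inv (D : X.ThetaData) (p : IsDedekindDomain.HeightOneSpectrum (RingOfIntegers X.E))
    (xm : X.Tuple) (hab : LinearIndependent X.E ![xm 0, xm 1])
    {level : ℕ → X.Level} (loc : ∀ N, X.Tr (level N))
    (hsupp : X.SuppU D p xm loc) (hinv : X.GrowthInvOn D loc) :
    ∃ (B q₂ e κ C₁ c₁ : ℝ), 0 < κ ∧ 0 ≤ B ∧ 0 ≤ q₂ ∧ 0 ≤ C₁ ∧ 0 < c₁ ∧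
      ∀ (N : ℕ) (w : X.LineTuple) (z : Fin 2 → ℂ), z ∈ ball →
      X.orbitOf w ∉ X.GramRay xm →
      ‖X.summand D.Φ D.cf (loc N) w z‖ ≤ B * q₂ ^ N * X.invMajorant D e c₁ w z *
        (C₁ * Real.exp (-(κ * (((Ideal.absNorm p.asIdeal : ℝ) ^ N) ^ ((Module.finrank ℚ X.E : ℝ)⁻¹))))) := by
  classical
  obtain ⟨S, hS, hsupp⟩ := hsupp
  obtain ⟨B, q₂, e, c₀, hc₀, hq₂, hgrowth⟩ := hinv
  have hSfg : ∀ L ∈ S, L.FG := fun L hL => (hS L hL).1.1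
  have hG : X.gram xm 0 0 ≠ 0 := X.gram_zero_zero_ne_zero xm (X.xm_zero_ne_zero_of_linearIndependent xm hab)
  obtain ⟨D₀, hD₀, hdev⟩ := X.exists_gram_minor_size p S hSfg xm hG
  have hdpos : 0 < Module.finrank ℚ X.E := Module.finrank_pos
  -- the constants, kept opaque
  obtain ⟨Dmax, hDmax_pos, hDmax_ge⟩ : ∃ Dmax : ℝ, 0 < Dmax ∧
      ∀ σ : X.E →+* ℂ, ‖σ (algebraMap (RingOfIntegers X.E) X.E D₀)‖ ≤ Dmax := by
    refine ⟨∑ σ : X.E →+* ℂ, ‖σ (algebraMap (RingOfIntegers X.E) X.E D₀)‖, ?_, fun σ =>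
      Finset.single_le_sum (f := fun σ : X.E →+* ℂ => ‖σ (algebraMap (RingOfIntegers X.E) X.E D₀)‖)
        (fun _ _ => norm_nonneg _) (Finset.mem_univ σ)⟩
    obtain ⟨σ₀⟩ : Nonempty (X.E →+* ℂ) := inferInstance
    have hD₀E : algebraMap (RingOfIntegers X.E) X.E D₀ ≠ 0 := by
      intro h
      exact hD₀ ((map_eq_zero_iff _ (RingOfIntegers.coe_injective (K := X.E))).mp h)
    exact lt_of_lt_of_le (norm_pos_iff.mpr ((map_ne_zero σ₀).mpr hD₀E))
      (Finset.single_le_sum (f := fun σ : X.E →+* ℂ => ‖σ (algebraMap (RingOfIntegers X.E) X.E D₀)‖)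
        (fun _ _ => norm_nonneg _) (Finset.mem_univ σ₀))
  obtain ⟨G₀, hG₀_pos, hG₀_ge⟩ : ∃ G₀ : ℝ, 0 < G₀ ∧ ∀ (σ : X.E →+* ℂ) (i j : Fin 4), ‖σ (X.gram xm i j)‖ ≤ G₀ := by
    have hge : ∀ (σ : X.E →+* ℂ) (i j : Fin 4), ‖σ (X.gram xm i j)‖ ≤ ∑ σ : X.E →+* ℂ, ∑ i, ∑ j, ‖σ (X.gram xm i j)‖ := by
      intro σ i j
      calc ‖σ (X.gram xm i j)‖ ≤ ∑ j, ‖σ (X.gram xm i j)‖ :=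
            Finset.single_le_sum (f := fun j => ‖σ (X.gram xm i j)‖) (fun _ _ => norm_nonneg _) (Finset.mem_univ j)
        _ ≤ ∑ i, ∑ j, ‖σ (X.gram xm i j)‖ :=
            Finset.single_le_sum (f := fun i => ∑ j, ‖σ (X.gram xm i j)‖)
              (fun _ _ => Finset.sum_nonneg fun _ _ => norm_nonneg _) (Finset.mem_univ i)
        _ ≤ ∑ σ : X.E →+* ℂ, ∑ i, ∑ j, ‖σ (X.gram xm i j)‖ :=
            Finset.single_le_sum (f := fun σ : X.E →+* ℂ => ∑ i, ∑ j, ‖σ (X.gram xm i j)‖)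
              (fun _ _ => Finset.sum_nonneg fun _ _ => Finset.sum_nonneg fun _ _ => norm_nonneg _) (Finset.mem_univ σ)
    obtain ⟨σ₀⟩ : Nonempty (X.E →+* ℂ) := inferInstance
    refine ⟨_, lt_of_lt_of_le ?_ (hge σ₀ 0 0), hge⟩
    exact norm_pos_iff.mpr ((map_ne_zero σ₀).mpr hG)
  obtain ⟨K, hK_pos, hK_ge⟩ : ∃ K : ℝ, 0 < K ∧ ∀ σ : X.E →+* ℂ, ∑ k, ∑ l, ‖σ (X.H k l)‖ ≤ K := by
    refine ⟨∑ σ : X.E →+* ℂ, ∑ k, ∑ l, ‖σ (X.H k l)‖, ?_, fun σ =>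
      Finset.single_le_sum (f := fun σ : X.E →+* ℂ => ∑ k, ∑ l, ‖σ (X.H k l)‖)
        (fun _ _ => Finset.sum_nonneg fun _ _ => Finset.sum_nonneg fun _ _ => norm_nonneg _) (Finset.mem_univ σ)⟩
    obtain ⟨σ₀⟩ : Nonempty (X.E →+* ℂ) := inferInstance
    exact lt_of_lt_of_le (X.sum_norm_emb_H_pos σ₀)
      (Finset.single_le_sum (f := fun σ : X.E →+* ℂ => ∑ k, ∑ l, ‖σ (X.H k l)‖)
        (fun _ _ => Finset.sum_nonneg fun _ _ => Finset.sum_nonneg fun _ _ => norm_nonneg _) (Finset.mem_univ σ₀))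
  obtain ⟨κ₀, hκ₀_pos, hκ₀_le1, hκ₀_le2⟩ : ∃ κ₀ : ℝ, 0 < κ₀ ∧ κ₀ ≤ Real.pi / 4 ∧ κ₀ ≤ c₀ / (2 * K) :=
    ⟨min (Real.pi / 4) (c₀ / (2 * K)), lt_min (by positivity) (by positivity), min_le_left _ _, min_le_right _ _⟩
  refine ⟨max B 0, q₂, e, κ₀ / (2 * Dmax * G₀), 1, c₀, by positivity, le_max_right _ _, hq₂,
    zero_le_one, hc₀, ?_⟩
  intro N w z hz hne
  -- the trivial case: zero coefficient
  by_cases hc : X.coefQ D.cf (loc N) (X.rep w) = 0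
  · unfold summand
    rw [hc, zero_mul, norm_zero]
    exact mul_nonneg (mul_nonneg (mul_nonneg (le_max_right _ _) (pow_nonneg hq₂ _))
      (X.invMajorant_nonneg _ _ _ _ _)) (mul_nonneg zero_le_one (Real.exp_pos _).le)
  obtain ⟨l, x, L, hL, _hl0, hl, hball, hx⟩ := hsupp N w hc
  have hball' : ∀ j, x j - l • xm j ∈ X.ballIdeal p N • L := fun j => X.mem_ballIdeal_smul_of_suppU p N (hball j)
  have hne' : X.orbitOf (X.lines x) ∉ X.GramRay xm := by rwa [hx]
  obtain ⟨i, j, σ, hσ⟩ := hdev N l x L hL hl hball' hne'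
  -- the `d`-th root: `RN ≤ ‖σ D₀‖ ‖σ α‖`
  obtain ⟨RN, hRN⟩ : ∃ RN : ℝ, RN = ((Ideal.absNorm p.asIdeal : ℝ) ^ N) ^ ((Module.finrank ℚ X.E : ℝ)⁻¹) := ⟨_, rfl⟩
  obtain ⟨α, hα⟩ : ∃ α : X.E, α = X.gramMinor xm x i j := ⟨_, rfl⟩
  have hroot : RN ≤ ‖σ (algebraMap (RingOfIntegers X.E) X.E D₀)‖ * ‖σ α‖ := by
    have h1 : ((Ideal.absNorm p.asIdeal : ℝ) ^ N) ^ ((Module.finrank ℚ X.E : ℝ)⁻¹) ≤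
        ((‖σ (algebraMap (RingOfIntegers X.E) X.E D₀)‖ * ‖σ α‖) ^ Module.finrank ℚ X.E) ^
          ((Module.finrank ℚ X.E : ℝ)⁻¹) := by
      apply Real.rpow_le_rpow (by positivity) _ (by positivity)
      rw [mul_pow, hα]
      exact hσ
    rw [Real.pow_rpow_inv_natCast (by positivity) hdpos.ne'] at h1
    rw [hRN]
    exact h1
  have hα_ge : RN / Dmax ≤ ‖σ α‖ := by
    rw [div_le_iff₀ hDmax_pos]
    calc RN ≤ ‖σ (algebraMap (RingOfIntegers X.E) X.E D₀)‖ * ‖σ α‖ := hroot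
      _ ≤ Dmax * ‖σ α‖ := mul_le_mul_of_nonneg_right (hDmax_ge σ) (norm_nonneg _)
      _ = ‖σ α‖ * Dmax := mul_comm _ _
  -- a large minor forces a large Gram entry of the ball representative: `G_ij(x)` or `G₀₀(x)`
  obtain ⟨R', hR'⟩ : ∃ R' : ℝ, R' = RN / (2 * Dmax * G₀) := ⟨_, rfl⟩
  have hminor : ‖σ α‖ ≤ G₀ * (‖σ (X.gram x i j)‖ + ‖σ (X.gram x 0 0)‖) := by
    rw [hα]
    exact X.norm_gramMinor_le xm x σ (hG₀_ge σ) i j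
  have hentry : ∃ i' j' : Fin 4, R' ≤ ‖σ (X.gram x i' j')‖ := by
    by_contra hcon
    have h1 : ‖σ (X.gram x i j)‖ < R' := by
      by_contra h
      exact hcon ⟨i, j, not_lt.mp h⟩
    have h2 : ‖σ (X.gram x 0 0)‖ < R' := by
      by_contra h
      exact hcon ⟨0, 0, not_lt.mp h⟩
    have h3 : ‖σ α‖ < G₀ * (2 * R') := by
      calc ‖σ α‖ ≤ G₀ * (‖σ (X.gram x i j)‖ + ‖σ (X.gram x 0 0)‖) := hminor
        _ < G₀ * (2 * R') := by
            apply mul_lt_mul_of_pos_left _ hG₀_pos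
            linarith
    have h4 : G₀ * (2 * R') = RN / Dmax := by
      rw [hR']
      field_simp
    linarith
  obtain ⟨i', j', hgram_ge⟩ := hentry
  -- the chosen representative is a unit multiple of the ball representative: same Gram sizes
  choose t ht hrep using fun k => X.rep_eq_smul_of_lines_eq hx k
  have hgram_rep : R' ≤ ‖σ (X.gram (X.rep w) i' j')‖ := by
    show R' ≤ ‖σ (hform X.c X.H (X.rep w i') (X.rep w j'))‖
    rw [hrep i', hrep j', X.norm_emb_hform_smul_eq σ (ht i') (ht j')]
    exact hgram_ge
  -- the decay
  have hdecay := X.decay_quarter_of_gram_entry hc₀ hK_ge hκ₀_pos hκ₀_le1 hκ₀_le2 (X.rep w) hz σ i' j' hgram_rep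
  -- the kernel is the kernel majorant times the quarter Gaussians
  obtain ⟨Hf, hHf⟩ : ∃ Hf : ℝ, Hf = ∏ k, Real.exp (-(Real.pi / 4) * maj (X.ballCoord (X.rep w k)) z) := ⟨_, rfl⟩
  have hHf0 : 0 ≤ Hf := by rw [hHf]; exact Finset.prod_nonneg fun k _ => (Real.exp_pos _).le
  have hker : ‖X.kernel D.Φ (X.rep w) z‖ = X.kerMaj D (X.rep w) z * Hf := by
    unfold kerMaj
    rw [hHf, mul_assoc, ← Finset.prod_mul_distrib]
    have h1 : ∀ k, Real.exp (Real.pi / 4 * maj (X.ballCoord (X.rep w k)) z) *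
        Real.exp (-(Real.pi / 4) * maj (X.ballCoord (X.rep w k)) z) = 1 := fun k => by
      rw [← Real.exp_add, show Real.pi / 4 * maj (X.ballCoord (X.rep w k)) z +
        -(Real.pi / 4) * maj (X.ballCoord (X.rep w k)) z = 0 by ring, Real.exp_zero]
    simp only [h1, Finset.prod_const_one, mul_one]
  rw [← hHf] at hdecay
  -- the bound for every `g ∈ Γ⁴`
  have hkm0 : 0 ≤ X.kerMaj D (X.rep w) z := X.kerMaj_nonneg D _ z
  have hg : ∀ g : Fin 4 → X.Γ, ‖X.summand D.Φ D.cf (loc N) w z‖ ≤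
      (max B 0 * q₂ ^ N * X.kerMaj D (X.rep w) z * Real.exp (-(κ₀ * R'))) * X.quadMaj e c₀ (X.rep w) g := by
    intro g
    unfold summand
    rw [norm_mul, hker]
    have hcoef' : ‖X.coefQ D.cf (loc N) (X.rep w)‖ ≤
        max B 0 * q₂ ^ N * X.quadMaj e c₀ (X.rep w) g * ∏ k, X.gaussDefAt c₀ (X.rep w k) :=
      (hgrowth N w g).trans (mul_le_mul_of_nonneg_right (mul_le_mul_of_nonneg_right
        (mul_le_mul_of_nonneg_right (le_max_left _ _) (pow_nonneg hq₂ _)) (X.quadMaj_nonneg _ _ _ _))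
        (Finset.prod_nonneg fun _ _ => X.gaussDefAt_nonneg _ _))
    calc ‖X.coefQ D.cf (loc N) (X.rep w)‖ * (X.kerMaj D (X.rep w) z * Hf)
        ≤ (max B 0 * q₂ ^ N * X.quadMaj e c₀ (X.rep w) g * ∏ k, X.gaussDefAt c₀ (X.rep w k)) *
            (X.kerMaj D (X.rep w) z * Hf) :=
          mul_le_mul_of_nonneg_right hcoef' (mul_nonneg hkm0 hHf0)
      _ = (max B 0 * q₂ ^ N * X.kerMaj D (X.rep w) z * X.quadMaj e c₀ (X.rep w) g) *
            ((∏ k, X.gaussDefAt c₀ (X.rep w k)) * Hf) := by ring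
      _ ≤ (max B 0 * q₂ ^ N * X.kerMaj D (X.rep w) z * X.quadMaj e c₀ (X.rep w) g) * Real.exp (-(κ₀ * R')) :=
          mul_le_mul_of_nonneg_left hdecay (mul_nonneg (mul_nonneg (mul_nonneg (le_max_right _ _)
            (pow_nonneg hq₂ _)) hkm0) (X.quadMaj_nonneg _ _ _ _))
      _ = (max B 0 * q₂ ^ N * X.kerMaj D (X.rep w) z * Real.exp (-(κ₀ * R'))) * X.quadMaj e c₀ (X.rep w) g := by
          ring
  -- pass to the infimum over `Γ⁴`
  have hinf : ‖X.summand D.Φ D.cf (loc N) w z‖ ≤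
      (max B 0 * q₂ ^ N * X.kerMaj D (X.rep w) z * Real.exp (-(κ₀ * R'))) * X.gammaInf e c₀ (X.rep w) := by
    unfold gammaInf
    rw [Real.mul_iInf_of_nonneg (mul_nonneg (mul_nonneg (mul_nonneg (le_max_right _ _) (pow_nonneg hq₂ _)) hkm0)
      (Real.exp_pos _).le)]
    haveI := X.nonempty_gammaFour
    exact le_ciInf hg
  -- assemble
  have hexp : Real.exp (-(κ₀ * R')) = 1 * Real.exp (-(κ₀ / (2 * Dmax * G₀) * RN)) := by
    rw [one_mul, hR']
    congr 1
    field_simp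
  calc ‖X.summand D.Φ D.cf (loc N) w z‖
      ≤ (max B 0 * q₂ ^ N * X.kerMaj D (X.rep w) z * Real.exp (-(κ₀ * R'))) * X.gammaInf e c₀ (X.rep w) := hinf
    _ = max B 0 * q₂ ^ N * X.invMajorant D e c₀ w z * (1 * Real.exp (-(κ₀ / (2 * Dmax * G₀) * RN))) := by
        unfold invMajorant
        rw [hexp]
        ring
    _ = max B 0 * q₂ ^ N * X.invMajorant D e c₀ w z *
        (1 * Real.exp (-(κ₀ / (2 * Dmax * G₀) *
          (((Ideal.absNorm p.asIdeal : ℝ) ^ N) ^ ((Module.finrank ℚ X.E : ℝ)⁻¹))))) := by rw [hRN]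

end T4Data

end Summit.Ventures.HodgeRepro.Tier4.Line3

end
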